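import Literature.RepresentationTheory.BorelWallach2000.UpqHarmonicHodgeDecomposition
import Literature.RepresentationTheory.BorelWallach2000.UpqConjugateModule
import Literature.RepresentationTheory.BorelWallach2000.AdmissibleFiniteCochains
import Literature.NumberTheory.Automorphic.GKModules
import HarnessLib

/-!
# FLOOR-0 P3b «ENGINE local packets» — the archimedean `T6` package, THEOREMS-SIDE TWIN (definitions)

Cell hodgecm-mathlib (D-0151), FLOOR 0, crux item H413 = stmt-HodgeConjecture-24833.  This is the floor-importable twin
(F0P3b-plan (g3) 2026-08-30T23:33Z, «the ENGINE's T6 EXIT for P2a ∕ P4a ∕ the integrator; Lines are never imported»)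
of the crux workfile `Cruxes/H413/Lines/F0_EngineLocalPackets.lean` (ed. 2.x): THIS FILE carries the DEFINITIONS —
the honest predicates over the Borel–Wallach `U(α, β)` layer (`IsUnitaryAlongP`, `IsCohUnitaryIrrep`, `IsPNull`), the
archimedean parameter bookkeeping (`ArchXi`, `xiPlus`, `xiMinus`, `degOneTypeOfXi`) and the nine `Stub…` statements
(T6d, T3j, T6g, T6r, T6k, T6e, T6a, T6b, T6c) plus the package `ArchDegOnePackage`, every def body VERBATIM from the
workfile (so the workfile can later fold onto these by `Iff.rfl`-free name equality of bodies); the companion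
`Theorems/F0P3bArchDegOnePackage.lean` proves all nine and the package from the ★ closers BY NAME.  Author F0P3-p04 (g2).
Source: [Rogawski1990] Prop. 15.2.1 (b) p. 244, §12.3; [BorelWallach2000] II §4.1–4.2, VI Thm. 4.11; [VoganZuckerman1984] Thm. 5.6.

HONEST LABEL: HC_CM is proved only modulo the printed citations until rung 0 closes; this file asserts nothing (definitions only).
-/

set_option autoImplicit false
set_option linter.dupNamespace false

noncomputable section

open scoped TensorProduct

namespace Summit.HodgeConjecture.HodgeConjecture.Cruxes.H413.F0P3bArchDegOnePackage

open Literature.Algebra.Lie Literature.Algebra.Lie.ChevalleyEilenberg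
open Literature.NumberTheory.Automorphic
open Literature.RepresentationTheory.BorelWallach2000
open Literature.RepresentationTheory.KonnoKonno2007 Literature.RepresentationTheory.KonnoKonno2007.RealDualPair
open Literature.RepresentationTheory.KonnoKonno2007.RealDualPair.UForm

-- Mathlib idiom (as in `GKModules`, `GKCohomology`, the `Upq*` files): commutator bracket on `Module.End`
attribute [local instance 100] LieRing.ofAssociativeRing

/-! ## §1 Honest predicates over the Borel–Wallach `U(α, β)` layer (VERBATIM) -/

section Predicates

variable {α β : Type*} [Fintype α] [DecidableEq α] [Fintype β] [DecidableEq β]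
  {V : Type*} [AddCommGroup V] [Module ℂ V]
  (ρK : Representation ℂ (uFormGroup α β).maximalCompact V)
  (ρ𝔤 : (uFormGroup α β).lie →ₗ⁅ℝ⁆ Module.End ℂ V)

/-- **`V` is unitary along `𝔭 ⊕ ℝz₀`** (the hypothesis bundle `hBs hB hBd hadj hBz hBI` of `UpqHodgeBigrading` §44′ as one
`Prop`; def body VERBATIM from the Lines workfile). (BorelWallach2000, II §2.1, §3.1)
— a route-posited statement of the engine line, not a result of the literature (hence untagged). -/
def IsUnitaryAlongP : Prop :=
  ∃ B : GKCarrier (uFormGroup α β) ρ𝔤 →ₗ[ℝ] GKCarrier (uFormGroup α β) ρ𝔤 →ₗ[ℝ] ℝ,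
    (∀ a b, B a b = B b a) ∧ (∀ a, 0 ≤ B a a) ∧ (∀ a, B a a = 0 → a = 0) ∧
    (∀ (s : (α × β) × Fin 2) (a b : GKCarrier (uFormGroup α β) ρ𝔤),
        B ⁅upqPBasis s, a⁆ b = -B a ⁅upqPBasis s, b⁆) ∧
    (∀ a b : GKCarrier (uFormGroup α β) ρ𝔤, B ⁅upqZ0 α β, a⁆ b = -B a ⁅upqZ0 α β, b⁆) ∧
    (∀ a b : GKCarrier (uFormGroup α β) ρ𝔤, B (Complex.I • a) b = -B a (Complex.I • b))

/-- **An irreducible unitary cohomologically relevant `(𝔤, K)`-module of `U(α, β)`**: `IsGKModule`, `IsIrreducibleGK`,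
`IsAdmissibleGK`, unitary along `𝔭 ⊕ ℝz₀` (VERBATIM from the Lines workfile). (Rogawski1990, Prop. 15.2.1 (b))
— a route-posited statement of the engine line, not a result of the literature (hence untagged). -/
structure IsCohUnitaryIrrep : Prop where
  gk : IsGKModule (uFormGroup α β) ρK ρ𝔤
  irred : IsIrreducibleGK ρK ρ𝔤
  adm : IsAdmissibleGK ρK
  unit : IsUnitaryAlongP ρ𝔤

/-- **`𝔭^{∓}`-nullity of a vector**: `ρ𝔤(x_s) v + ε i · ρ𝔤(⁅z₀, x_s⁆) v = 0` on the `𝔭`-frame (`ε = 1`: killed by `𝔭⁻`;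
`ε = −1`: by `𝔭⁺`; VERBATIM from the Lines workfile). (BorelWallach2000, II §4.1)
— a route-posited statement of the engine line, not a result of the literature (hence untagged). -/
def IsPNull (ε : ℤ) (v : GKCarrier (uFormGroup α β) ρ𝔤) : Prop :=
  ∀ s : (α × β) × Fin 2, ⁅upqPBasis s, v⁆ + ((ε : ℂ) * Complex.I) • ⁅⁅upqZ0 α β, upqPBasis s⁆, v⁆ = 0

end Predicates

/-! ## §1′ Archimedean parameter bookkeeping for trivial coefficients (VERBATIM) -/

/-- Rogawski's one-dimensional archimedean parameters `ξ(a,b,c)` as integer triples. (Rogawski1990, §12.3 p. 176)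
— a route-posited statement of the engine line, not a result of the literature (hence untagged). -/
abbrev ArchXi : Type := ℤ × ℤ × ℤ

/-- `ξ⁺_∞ = ξ(0, 1, −1)`, the parameter with `πⁿ(ξ⁺_∞) = J⁺` (type `(1,0)`). (Rogawski1990, §12.3 p. 178)
— a route-posited statement of the engine line, not a result of the literature (hence untagged). -/
def xiPlus : ArchXi := (0, 1, -1)

/-- `ξ⁻_∞ = ξ(1, −1, 0)`, the parameter with `πⁿ(ξ⁻_∞) = J⁻` (type `(0,1)`). (Rogawski1990, §12.3 p. 178)
— a route-posited statement of the engine line, not a result of the literature (hence untagged). -/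
def xiMinus : ArchXi := (1, -1, 0)

/-- The degree-one Hodge type (`z₀`-weight) carried by `πⁿ(ξ)` for the two cohomological parameters, `none` otherwise.
(Rogawski1990, §12.3 p. 178; Prop. 15.2.1 (b))
— a route-posited statement of the engine line, not a result of the literature (hence untagged). -/
def degOneTypeOfXi (ξ : ArchXi) : Option ℤ :=
  if ξ = xiPlus then some 1 else if ξ = xiMinus then some (-1) else none

/-- `ξ⁺_∞ ≠ ξ⁻_∞` — the archimedean half of E2′ `hodgeTypeRigid` (a holomorphic and an antiholomorphic class cannot
lie in the same global A-packet). [cite: Rogawski1990, §15.3 ¶1] -/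
theorem xiPlus_ne_xiMinus : xiPlus ≠ xiMinus := by decide

/-- The two cohomological parameters carry opposite degree-one types. [cite: Rogawski1990, Prop. 15.2.1 (b)] -/
theorem degOneTypeOfXi_values : degOneTypeOfXi xiPlus = some 1 ∧ degOneTypeOfXi xiMinus = some (-1) := by
  refine ⟨by simp [degOneTypeOfXi], ?_⟩
  simp [degOneTypeOfXi, xiPlus, xiMinus]

/-! ## §2 The nine statements (def bodies VERBATIM = the registered ∕ folded stubs of the workfile) -/

section Stubs

variable {α β : Type*} [Fintype α] [DecidableEq α] [Fintype β] [DecidableEq β]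

/-- **T6d — the admissibility bridge** `IsGKModule → IsAdmissibleGK → IsKAdmissible` for `(𝔤, K)`-modules of `U(α, β)`
(def body VERBATIM = the registered stub; ★ closer `F0P3bStubT6dAdmissibleBridge.stubT6d_holds`, A-p12 (g12)).
(BorelWallach2000, 0 §2.4–2.5, II Prop. 3.4 (1))
— a route-posited statement of the engine line, not a result of the literature (hence untagged). -/
def StubT6dAdmissibleBridge : Prop :=
  ∀ (α β : Type) [Fintype α] [DecidableEq α] [Fintype β] [DecidableEq β]
    (V : Type) [AddCommGroup V] [Module ℂ V]
    (ρK : Representation ℂ (uFormGroup α β).maximalCompact V) (ρ𝔤 : (uFormGroup α β).lie →ₗ⁅ℝ⁆ Module.End ℂ V),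
    IsGKModule (uFormGroup α β) ρK ρ𝔤 → IsAdmissibleGK ρK → IsKAdmissible ρK

/-- **T3j — the junction lemma**: the values of a closed `(𝔤, K)`-1-cochain of type `δ = ±1` are `𝔭^{−δ}`-null
(VERBATIM = the registered stub; ★ closer `F0P3bStubT3jCocycleValuesPNull.stubT3j_holds`, A-p09 (g18)).
(BorelWallach2000, II §4.2 (3)) (Rogawski1990, §15.2)
— a route-posited statement of the engine line, not a result of the literature (hence untagged). -/
def StubT3jCocycleValuesPNull : Prop :=
  ∀ (α β : Type) [Fintype α] [DecidableEq α] [Fintype β] [DecidableEq β]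
    (V : Type) [AddCommGroup V] [Module ℂ V]
    (ρK : Representation ℂ (uFormGroup α β).maximalCompact V) (ρ𝔤 : (uFormGroup α β).lie →ₗ⁅ℝ⁆ Module.End ℂ V)
    (hV : ∀ (k : (uFormGroup α β).maximalCompact) (X : (uFormGroup α β).lie), ρK k ∘ₗ ρ𝔤 X ∘ₗ ρK k⁻¹ =
      ρ𝔤 ((uFormGroup α β).Ad (Subgroup.inclusion (uFormGroup α β).maximalCompact_le_carrier k) X))
    (δ : ℤ), δ * δ = 1 →
    ∀ (f : Cochain ℝ (uFormGroup α β).lie (GKCarrier (uFormGroup α β) ρ𝔤) 1),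
      f ∈ upqType ρK ρ𝔤 hV 1 δ → d ℝ (uFormGroup α β).lie (GKCarrier (uFormGroup α β) ρ𝔤) 1 f = 0 →
      ∀ Y : Fin 1 → (uFormGroup α β).lie, IsPNull ρ𝔤 δ (f Y)

/-- **T6g — `𝔭^{−δ}`-null generation and the `z₀`-grading** of an irreducible `(𝔤, K)`-module of `U(α, β)` carrying a
non-zero type-`δ` cochain with `𝔭^{−δ}`-null values: every `z₀`-eigenvalue is `δ(k+1)i` and the `δ i`-eigenspace is
`span f(𝔤)` (VERBATIM = the registered stub; closer F0P3-p01 (g2)). (BorelWallach2000, II §4.1, VI Thm. 4.11)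
— a route-posited statement of the engine line, not a result of the literature (hence untagged). -/
def StubT6gPNullGeneration : Prop :=
  ∀ (α β : Type) [Fintype α] [DecidableEq α] [Fintype β] [DecidableEq β]
    (V : Type) [AddCommGroup V] [Module ℂ V]
    (ρK : Representation ℂ (uFormGroup α β).maximalCompact V) (ρ𝔤 : (uFormGroup α β).lie →ₗ⁅ℝ⁆ Module.End ℂ V)
    (hV : ∀ (k : (uFormGroup α β).maximalCompact) (X : (uFormGroup α β).lie), ρK k ∘ₗ ρ𝔤 X ∘ₗ ρK k⁻¹ =
      ρ𝔤 ((uFormGroup α β).Ad (Subgroup.inclusion (uFormGroup α β).maximalCompact_le_carrier k) X)),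
    IsIrreducibleGK ρK ρ𝔤 →
    ∀ (δ : ℤ), δ = 1 ∨ δ = -1 →
    ∀ (f : Cochain ℝ (uFormGroup α β).lie (GKCarrier (uFormGroup α β) ρ𝔤) 1),
      f ∈ upqType ρK ρ𝔤 hV 1 δ → f ≠ 0 → (∀ Y : Fin 1 → (uFormGroup α β).lie, IsPNull ρ𝔤 δ (f Y)) →
      (∀ (μ : ℂ) (v : GKCarrier (uFormGroup α β) ρ𝔤), v ≠ 0 → ρ𝔤 (upqZ0 α β) v = μ • v →
          ∃ k : ℕ, μ = ((δ * ((k : ℤ) + 1) : ℤ) : ℂ) * Complex.I) ∧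
      (∀ v : GKCarrier (uFormGroup α β) ρ𝔤, ρ𝔤 (upqZ0 α β) v = ((δ : ℂ) * Complex.I) • v →
          v ∈ Submodule.span ℂ (Set.range fun X : (uFormGroup α β).lie => f ![X]))

/-- **T6r — rigidity from the generating datum**: two irreducible `(𝔤, K)`-modules of `U(α, β)` with non-zero
`𝔭^{−δ}`-null type-`δ` cochains of equal kernel are `(𝔤, K)`-equivalent (VERBATIM = the registered stub; ★ closer
`F0P3bStubT6rPNullRigidity.stubT6r_holds`, F0P3-p03 (g2)). (BorelWallach2000, VI Thm. 4.11 (1)) (VoganZuckerman1984, Thm. 5.6)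
— a route-posited statement of the engine line, not a result of the literature (hence untagged). -/
def StubT6rPNullRigidity : Prop :=
  ∀ (α β : Type) [Fintype α] [DecidableEq α] [Fintype β] [DecidableEq β]
    (V : Type) [AddCommGroup V] [Module ℂ V]
    (ρK : Representation ℂ (uFormGroup α β).maximalCompact V) (ρ𝔤 : (uFormGroup α β).lie →ₗ⁅ℝ⁆ Module.End ℂ V)
    (hV : ∀ (k : (uFormGroup α β).maximalCompact) (X : (uFormGroup α β).lie), ρK k ∘ₗ ρ𝔤 X ∘ₗ ρK k⁻¹ =
      ρ𝔤 ((uFormGroup α β).Ad (Subgroup.inclusion (uFormGroup α β).maximalCompact_le_carrier k) X))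
    (V' : Type) [AddCommGroup V'] [Module ℂ V']
    (ρK' : Representation ℂ (uFormGroup α β).maximalCompact V') (ρ𝔤' : (uFormGroup α β).lie →ₗ⁅ℝ⁆ Module.End ℂ V')
    (hV' : ∀ (k : (uFormGroup α β).maximalCompact) (X : (uFormGroup α β).lie), ρK' k ∘ₗ ρ𝔤' X ∘ₗ ρK' k⁻¹ =
      ρ𝔤' ((uFormGroup α β).Ad (Subgroup.inclusion (uFormGroup α β).maximalCompact_le_carrier k) X)),
    IsIrreducibleGK ρK ρ𝔤 → IsIrreducibleGK ρK' ρ𝔤' →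
    ∀ (δ : ℤ), δ = 1 ∨ δ = -1 →
    ∀ (f : Cochain ℝ (uFormGroup α β).lie (GKCarrier (uFormGroup α β) ρ𝔤) 1)
      (f' : Cochain ℝ (uFormGroup α β).lie (GKCarrier (uFormGroup α β) ρ𝔤') 1),
      f ∈ upqType ρK ρ𝔤 hV 1 δ → f' ∈ upqType ρK' ρ𝔤' hV' 1 δ → f ≠ 0 → f' ≠ 0 →
      (∀ Y : Fin 1 → (uFormGroup α β).lie, IsPNull ρ𝔤 δ (f Y)) →
      (∀ Y : Fin 1 → (uFormGroup α β).lie, IsPNull ρ𝔤' δ (f' Y)) →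
      (∀ X : (uFormGroup α β).lie, f ![X] = 0 ↔ f' ![X] = 0) →
      AreGKEquivalent ρK ρ𝔤 ρK' ρ𝔤'

/-- **T6k — the `𝔭`-geometry of `U(2,1)`**: for a non-zero type-`δ` `(𝔤, K)`-1-cochain `f`, `f(X) = 0 ↔ X ∈ 𝔨`, and a
second type-`δ` cochain with values in `span f(𝔤)` is `c • f` (VERBATIM = the registered stub; ★ closer
`F0P3bStubT6kU21PGeometry.stubT6k_holds`, F0P3-p04 (g2)). (BorelWallach2000, II §4.1–4.2) (Rogawski1990, §12.3 p. 178)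
— a route-posited statement of the engine line, not a result of the literature (hence untagged). -/
def StubT6kU21PGeometry : Prop :=
  ∀ (V : Type) [AddCommGroup V] [Module ℂ V]
    (ρK : Representation ℂ (uFormGroup (Fin 2) (Fin 1)).maximalCompact V)
    (ρ𝔤 : (uFormGroup (Fin 2) (Fin 1)).lie →ₗ⁅ℝ⁆ Module.End ℂ V)
    (hV : ∀ (k : (uFormGroup (Fin 2) (Fin 1)).maximalCompact) (X : (uFormGroup (Fin 2) (Fin 1)).lie),
      ρK k ∘ₗ ρ𝔤 X ∘ₗ ρK k⁻¹ =
        ρ𝔤 ((uFormGroup (Fin 2) (Fin 1)).Ad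
          (Subgroup.inclusion (uFormGroup (Fin 2) (Fin 1)).maximalCompact_le_carrier k) X))
    (δ : ℤ), δ = 1 ∨ δ = -1 →
    ∀ (f g : Cochain ℝ (uFormGroup (Fin 2) (Fin 1)).lie (GKCarrier (uFormGroup (Fin 2) (Fin 1)) ρ𝔤) 1),
      f ∈ upqType ρK ρ𝔤 hV 1 δ → g ∈ upqType ρK ρ𝔤 hV 1 δ → f ≠ 0 →
      (∀ X : (uFormGroup (Fin 2) (Fin 1)).lie, f ![X] = 0 ↔ X ∈ (uFormGroup (Fin 2) (Fin 1)).kInLie) ∧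
      ((∀ X : (uFormGroup (Fin 2) (Fin 1)).lie,
          g ![X] ∈ Submodule.span ℂ (Set.range fun Y : (uFormGroup (Fin 2) (Fin 1)).lie => f ![Y])) →
        ∃ c : ℂ, ∀ X : (uFormGroup (Fin 2) (Fin 1)).lie, g ![X] = c • f ![X])

/-- **T6e — Dixmier–Schur**: on an irreducible admissible `(𝔤, K)`-module of `U(α, β)` the Casimir operator acts by a scalar
(VERBATIM = the registered stub; ★ closer `F0P3bStubT6eCasimirScalar.stubT6e_holds`, A-p09 (g18)).
(BorelWallach2000, II §3.1, Cor. 3.3) (KnappVogan1995, Cor. 2.78)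
— a route-posited statement of the engine line, not a result of the literature (hence untagged). -/
def StubT6eCasimirScalar : Prop :=
  ∀ (α β : Type) [Fintype α] [DecidableEq α] [Fintype β] [DecidableEq β]
    (V : Type) [AddCommGroup V] [Module ℂ V]
    (ρK : Representation ℂ (uFormGroup α β).maximalCompact V) (ρ𝔤 : (uFormGroup α β).lie →ₗ⁅ℝ⁆ Module.End ℂ V),
    IsGKModule (uFormGroup α β) ρK ρ𝔤 → IsIrreducibleGK ρK ρ𝔤 → IsAdmissibleGK ρK →
    ∃ c : ℂ, ∀ v : V, upqCasimirOp ρ𝔤 v = c • v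

/-- **T6a — purity of degree-one cohomology**: an irreducible unitary `(𝔤, K)`-module of `U(2,1)` has `H¹_{+1} = 0` or
`H¹_{−1} = 0` (VERBATIM from the Lines workfile; derived below from T3j + T6g). (BorelWallach2000, VI Thm. 4.11) (Rogawski1990, Prop. 15.2.1 (b))
— a route-posited statement of the engine line, not a result of the literature (hence untagged). -/
def StubT6aDegOneTypePure : Prop :=
  ∀ (V : Type) [AddCommGroup V] [Module ℂ V]
    (ρK : Representation ℂ (uFormGroup (Fin 2) (Fin 1)).maximalCompact V)
    (ρ𝔤 : (uFormGroup (Fin 2) (Fin 1)).lie →ₗ⁅ℝ⁆ Module.End ℂ V) (h : IsCohUnitaryIrrep ρK ρ𝔤),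
    upqTypeClasses ρK ρ𝔤 h.gk.ad_compat 1 1 = ⊥ ∨ upqTypeClasses ρK ρ𝔤 h.gk.ad_compat 1 (-1) = ⊥

/-- **T6b — each degree-one Hodge piece is at most a complex line**: `H¹_δ` finite of real dimension `≤ 2` (VERBATIM;
derived below from T3j + T6g + T6k). (BorelWallach2000, VI Thm. 4.11 (3)) (Rogawski1990, Prop. 15.2.1 (b))
— a route-posited statement of the engine line, not a result of the literature (hence untagged). -/
def StubT6bDegOneTypeFinrank : Prop :=
  ∀ (V : Type) [AddCommGroup V] [Module ℂ V]
    (ρK : Representation ℂ (uFormGroup (Fin 2) (Fin 1)).maximalCompact V)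
    (ρ𝔤 : (uFormGroup (Fin 2) (Fin 1)).lie →ₗ⁅ℝ⁆ Module.End ℂ V) (h : IsCohUnitaryIrrep ρK ρ𝔤) (δ : ℤ),
    Module.Finite ℝ ↥(upqTypeClasses ρK ρ𝔤 h.gk.ad_compat 1 δ) ∧
      Module.finrank ℝ ↥(upqTypeClasses ρK ρ𝔤 h.gk.ad_compat 1 δ) ≤ 2

/-- **T6c — rigidity of the degree-one classes**: two irreducible unitary `(𝔤, K)`-modules of `U(2,1)` with non-zero `H¹_δ` for
the same `δ ∈ {±1}` are `(𝔤, K)`-equivalent (VERBATIM; derived below from T3j + T6k + T6r).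
(BorelWallach2000, VI Thm. 4.11 (1)) (Rogawski1990, Prop. 15.2.1 (b)) (VoganZuckerman1984, Thm. 5.6)
— a route-posited statement of the engine line, not a result of the literature (hence untagged). -/
def StubT6cDegOneTypeRigid : Prop :=
  ∀ (V : Type) [AddCommGroup V] [Module ℂ V]
    (ρK : Representation ℂ (uFormGroup (Fin 2) (Fin 1)).maximalCompact V)
    (ρ𝔤 : (uFormGroup (Fin 2) (Fin 1)).lie →ₗ⁅ℝ⁆ Module.End ℂ V) (h : IsCohUnitaryIrrep ρK ρ𝔤)
    (V' : Type) [AddCommGroup V'] [Module ℂ V']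
    (ρK' : Representation ℂ (uFormGroup (Fin 2) (Fin 1)).maximalCompact V')
    (ρ𝔤' : (uFormGroup (Fin 2) (Fin 1)).lie →ₗ⁅ℝ⁆ Module.End ℂ V') (h' : IsCohUnitaryIrrep ρK' ρ𝔤')
    (δ : ℤ), δ = 1 ∨ δ = -1 →
    upqTypeClasses ρK ρ𝔤 h.gk.ad_compat 1 δ ≠ ⊥ → upqTypeClasses ρK' ρ𝔤' h'.gk.ad_compat 1 δ ≠ ⊥ →
    AreGKEquivalent ρK ρ𝔤 ρK' ρ𝔤'

end Stubs

/-! ## §3 The package -/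

/-- **The T6 package** — purity, `dim ≤ 1`, rigidity, the admissibility bridge, Dixmier–Schur and the junction lemma as ONE
`Prop` (VERBATIM from the Lines workfile). (Rogawski1990, Prop. 15.2.1 (b))
— a route-posited statement of the engine line, not a result of the literature (hence untagged). -/
def ArchDegOnePackage : Prop :=
  StubT6aDegOneTypePure ∧ StubT6bDegOneTypeFinrank ∧ StubT6cDegOneTypeRigid ∧
    StubT6dAdmissibleBridge ∧ StubT6eCasimirScalar ∧ StubT3jCocycleValuesPNull

end Summit.HodgeConjecture.HodgeConjecture.Cruxes.H413.F0P3bArchDegOnePackage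

end
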